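import Literature.AnabelianGeometry.AbsoluteAnabelian.AbsTopIII.KummerCurveLaws
import HarnessLib

/-!
# [AbsTopIII] §1: per-curve laws — derived API (regular units along cofinite opens, constant units,
# cuspidal degrees of Kummer classes for every system of presentations)

Mochizuki, *Topics in Absolute Anabelian Geometry III*, §1, Prop. 1.6 pp. 34–35, Thm. 1.9 (b)(c) p. 37
(lit key `paper:url-5493eb38cbb7`).  Companion of `KummerCurveLaws.lean` (abc-iut-L4-t1, the successor
structure `NaturalKummerModel`): the DERIVED data and first consequences of the per-curve laws —

* `unitsRes` / `unitRes` — restriction of (regular) units along a cofinite open `U ⊆ X` ("`K_U = K_X`"),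
  injective (the `res` / `res_injective` data of abc-iut-w5-d213's per-system view `NFTower` for open
  legs); `constUnit` (constants are regular units, `NFTower.const_mem`);
* `kummerAddHom_unitRes` — naturality of `κ` in `unitRes` form (`NFTower.naturality` for open legs);
* `hasCuspidalDegree_kummer` — for EVERY system of cyclotome presentations `P : CuspSyncPresentation h`
  the Kummer class of a regular unit `f` of `U` has cuspidal degree `degSign · ord_y(f)` at each cusp
  (the degree law of the model instantiated at `P`'s third curves; definitionally abc-iut-w5-d213's
  `HasCuspidalDegree`).

HONEST FRAMING: consequences of interface laws; typed ≠ proved for the laws themselves; nothing here bears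
on [IUTchIII] Cor. 3.12.
-/

noncomputable section

open CategoryTheory
open scoped Classical Pointwise

namespace Literature.AnabelianGeometry.AbsoluteAnabelian.AbsTopIII

universe u

namespace NaturalKummerModel

variable (M : NaturalKummerModel.{u})

/-! ### Derived API: regular units along cofinite opens, constant units -/

/-- Transport of a rational function of `X` to the cofinite open `U ⊆ X` on units ("`K_U = K_X`").
[cite: MochizukiAbsTopIII2015, Prop 1.6 p.34] -/
def unitsRes {U X : M.Curve} (h : M.IsCofiniteOpen U X) : (M.FunctionField X)ˣ →* (M.FunctionField U)ˣ :=
  Units.map (M.fieldRes h).toRingHom.toMonoidHom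

/-- Formula for `unitsRes` on values. [cite: MochizukiAbsTopIII2015, Prop 1.6 p.34] -/
@[simp] theorem coe_unitsRes {U X : M.Curve} (h : M.IsCofiniteOpen U X) (f : (M.FunctionField X)ˣ) :
    ((M.unitsRes h f : (M.FunctionField U)ˣ) : M.FunctionField U) = M.fieldRes h f :=
  rfl

/-- `unitsRes` is injective (`fieldRes` is a field isomorphism). [cite: MochizukiAbsTopIII2015, Prop 1.6 p.34] -/
theorem unitsRes_injective {U X : M.Curve} (h : M.IsCofiniteOpen U X) :
    Function.Injective (M.unitsRes h) := by
  intro f g hfg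
  ext
  exact (M.fieldRes h).injective (by simpa using congrArg (fun u : (M.FunctionField U)ˣ => (u : M.FunctionField U)) hfg)

/-- A regular unit of `X` restricts to a regular unit of the cofinite open `U ⊆ X`
(`ord_x(f|_U) = ord_x(f) = 0` at every point of `U`, law `ord_ptRes`).
[cite: MochizukiAbsTopIII2015, Prop 1.6 p.34] -/
theorem unitsRes_mem_regularUnits {U X : M.Curve} (h : M.IsCofiniteOpen U X)
    {f : (M.FunctionField X)ˣ} (hf : f ∈ M.regularUnits X) : M.unitsRes h f ∈ M.regularUnits U := by
  intro x
  rw [unitsRes, ← M.ord_ptRes h x f]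
  exact hf (M.ptRes h x)

/-- **Restriction of regular units `Γ(X, 𝒪^×) → Γ(U, 𝒪^×)`** along a cofinite open `U ⊆ X`, written
additively (the `res` datum of the per-system view `NFTower` for open legs).
[cite: MochizukiAbsTopIII2015, Prop 1.6 p.34] -/
def unitRes {U X : M.Curve} (h : M.IsCofiniteOpen U X) :
    Additive (M.regularUnits X) →+ Additive (M.regularUnits U) :=
  MonoidHom.toAdditive
    { toFun := fun f => ⟨M.unitsRes h f, M.unitsRes_mem_regularUnits h f.2⟩
      map_one' := Subtype.ext (map_one _)
      map_mul' := fun _ _ => Subtype.ext (map_mul _ _ _) }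

/-- Formula for `unitRes`. [cite: MochizukiAbsTopIII2015, Prop 1.6 p.34] -/
@[simp] theorem coe_unitRes {U X : M.Curve} (h : M.IsCofiniteOpen U X) (f : M.regularUnits X) :
    ((Additive.toMul (M.unitRes h (Additive.ofMul f)) : M.regularUnits U) : (M.FunctionField U)ˣ) =
      M.unitsRes h f :=
  rfl

/-- Restriction of regular units is injective (`NFTower.res_injective` for open legs).
[cite: MochizukiAbsTopIII2015, Prop 1.6 p.34] -/
theorem unitRes_injective {U X : M.Curve} (h : M.IsCofiniteOpen U X) :
    Function.Injective (M.unitRes h) := by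
  intro a b hab
  have h1 : M.unitsRes h ((Additive.toMul a : M.regularUnits X) : (M.FunctionField X)ˣ) =
      M.unitsRes h ((Additive.toMul b : M.regularUnits X) : (M.FunctionField X)ˣ) :=
    congrArg
      (fun z : Additive (M.regularUnits U) =>
        ((Additive.toMul z : M.regularUnits U) : (M.FunctionField U)ˣ)) hab
  exact Additive.toMul.injective (Subtype.ext (M.unitsRes_injective h h1))

/-- The constant regular unit of `c ∈ k^×` (law `ord_const`; the `const_mem` datum of `NFTower`).
[cite: MochizukiAbsTopIII2015, Prop 1.6 (iii) p.35] -/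
def constUnit {U : M.Curve} (c : (M.base U)ˣ) : M.regularUnits U :=
  ⟨Units.map (algebraMap (M.base U) (M.FunctionField U) : M.base U →* M.FunctionField U) c,
    fun x => M.ord_const x c⟩

/-- The constant unit is a constant unit in the sense of `DivisorCurveModel.IsConstantUnit`.
[cite: MochizukiAbsTopIII2015, Prop 1.6 (iii) p.35] -/
theorem isConstantUnit_constUnit {U : M.Curve} (c : (M.base U)ˣ) :
    M.IsConstantUnit ((M.constUnit c : M.regularUnits U) : (M.FunctionField U)ˣ) :=
  ⟨c, rfl⟩

/-- **Naturality of `κ` along a cofinite open, `unitRes` form**: `κ_U(f|_U) = pull(κ_{U′}(f))`.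
[cite: MochizukiAbsTopIII2015, Prop 1.6 p.34] -/
theorem kummerAddHom_unitRes {U U' X : M.Curve} (h₁ : M.IsCofiniteOpen U U') (h₂ : M.IsCofiniteOpen U' X)
    (h : M.IsCofiniteOpen U X) (hX : M.IsProper X) (f : M.regularUnits U') :
    M.kummerAddHom h hX (M.unitRes h₁ (Additive.ofMul f)) =
      (cyclotomeModH1Pull ZHatCoeff.{u} (M.res h₁) (M.res h₂) (M.res h) (M.res_comp h₁ h₂ h)).hom
        (M.kummerAddHom h₂ hX (Additive.ofMul f)) :=
  M.kummer_natural h₁ h₂ h hX f (M.unitsRes_mem_regularUnits h₁ f.2)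

/-- Every system of cyclotome presentations over a `NaturalKummerModel` has its `res_comp` supplied by
the law `res_comp` (sanity: the datum carried by `CuspSyncPresentation` is consistent with the model).
[cite: MochizukiAbsTopIII2015, Thm 1.9 (b) p.37] -/
theorem res_comp_of_presentation {U Z : M.Curve} {h : M.IsCofiniteOpen U Z}
    (P : M.toCurveModel.CuspSyncPresentation h) (z : (M.cusps U).Cusp) :
    M.res (P.hU z) ≫ M.res (P.hZ z) = M.res h :=
  M.res_comp (P.hU z) (P.hZ z) h


/-- **Cuspidal degrees of Kummer classes, for every system of presentations** (Prop. 1.6 (iii)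
"`D ∘ κ_U = div`" read through the synchronizations of Thm. 1.9 (b)): for `P : CuspSyncPresentation h`
over a `NaturalKummerModel`, a regular unit `f` of `U` and a cusp `z` filling `y ∈ Z`, the class `κ_U(f)`
has cuspidal degree `degSign · ord_y(f)` at `z` in the sense of abc-iut-w5-d213's `HasCuspidalDegree`
(the law `kummer_degree` at `P`'s third curve `U ⊆ U_z ⊆ Z`; definitional).
[cite: MochizukiAbsTopIII2015, Thm 1.9 (c) p.37] -/
theorem hasCuspidalDegree_kummer {U Z : M.Curve} {h : M.IsCofiniteOpen U Z} (hZ : M.IsProper Z)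
    (P : M.toCurveModel.CuspSyncPresentation h) (f : M.regularUnits U) (z : (M.cusps U).Cusp)
    (y : M.Point Z) (hy : M.cuspPt h z = some y) :
    CurveModel.HasCuspidalDegree P (Multiplicative.toAdd (M.kummerMap h hZ f)) z
      ((M.degSign : ℤ) * Multiplicative.toAdd (M.ord y
        (Units.map (M.fieldRes h).symm.toRingHom.toMonoidHom (f : (M.FunctionField U)ˣ)))) :=
  M.kummer_degree (P.hU z) (P.hZ z) h hZ z (P.cusp z) (P.pres z) (P.inertia_le z)
    (P.inertia_bijOn z) y hy (P.sec z) (P.bij z) f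

end NaturalKummerModel

end Literature.AnabelianGeometry.AbsoluteAnabelian.AbsTopIII
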